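import Literature.Computability.QuantumComplexity.CoreDescUniform
import Literature.Computability.Cryptography.QuantumCircuitDescFP
import Literature.Computability.Complexity.LexCompareBricks
import HarnessLib

/-!
# From a uniform Clifford+T family to its abstract gate lists on codes

Topic `Literature/Computability/QuantumComplexity`; the converse companion of `AbstractGateUniform.lean`
(Arora–Barak 2009, §6.2 and Remark 6.7: uniformity = the description function is in `FP`). A uniformity proof
that EMBEDS a given uniform family `R` as a subroutine (Bennett–Bernstein–Brassard–Vazirani 1997, Thm. 4.14;
Regev 2009, Lemma 3.14: the oracle-solver inside the sampler) needs `R`'s own description as a map computed on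
codes, to be renamed (`AGmap`, `StageAbstract.lean`) and concatenated with the other stages:

* `AJLCore.agE0_of_agE` — from the primary code of an abstract gate to the working code (inverse of
  `AJLCore.agE_of_agE0` on codes);
* **`QCircuitFamily.desc_codeFP_of_isUniform`** — a uniform family's `n ↦ (n, ancillas n, (circ n).encode)` is
  computed on codes from `1ⁿ` (via the total description function `descFn ∈ FP`, `QuantumCircuitDescFP.lean`);
  `ancillas_codeFP_of_isUniform` — `n ↦ ancillas n` in unary;
* **`QCircuitFamily.abstract_codeFP_of_isUniform`** — for an oracle-free uniform family,
  `n ↦ (circ n).gates.map toAG` is computed on codes (`CodeFP unE (rawE agE0)`).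

No named fact is introduced.

HONEST FRAMING: the VALUE is a THEOREM (kernel-checked generic lemmas of KNOWN complexity theory) — NOT summit
progress; no trust base changes.

## References

* S. Arora, B. Barak, *Computational Complexity: A Modern Approach*, CUP 2009, §6.1–§6.2, Remark 6.7
  [AroraBarak2009].
* C. H. Bennett, E. Bernstein, G. Brassard, U. Vazirani, *Strengths and weaknesses of quantum computing*,
  SIAM J. Comput. 26 (1997), Thm. 4.14 [BennettBernsteinBrassardVazirani1997].
* O. Regev, *On lattices, learning with errors, random linear codes, and cryptography*, J. ACM 56(6) (2009),
  Lemma 3.14 (proof: uniformity) [Regev2009].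
-/

noncomputable section

namespace Literature.Computability.QuantumComplexity

open _root_.Computability Cryptography Complexity Complexity.CodeFP AJLCore RevDesc

/-! ### The working code from the primary code -/

/-- **From the code of a gate to the working code** (drop the tag bit, re-list the wires).
[cite: AroraBarak2009, §6.1] -/
theorem AJLCore.agE0_of_agE : CodeFP agE agE0 id := by
  have h : CodeFP (pairE natE (listE natE)) (pairE natE (rawE natE)) (fun p : ℕ × List ℕ => p) :=
    ((fst _ _).pair ((rawOfList natE).comp (snd _ _))).congr fun _ => rfl
  obtain ⟨f, hf, hfa⟩ := h
  refine ⟨f ∘ LexCmp.tailFn, comp_mem_FP hf LexCmp.tailFn_mem_FP, fun a => ?_⟩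
  show f (LexCmp.tailFn (agE a)) = agE0 a
  rw [agE, LexCmp.tailFn_apply, List.drop_one, List.tail_cons]
  exact hfa (symCode a.sym, a.wires)

/-! ### A uniform family on codes -/

namespace QCircuitFamily

open Cryptography.QCircuitFamily

variable (F : QCircuitFamily cliffordT)

/-- **A uniform family's description triple on codes**: from `1ⁿ`, the binary numeral of `n`, the ancilla count
in unary, and the gate-list code of the circuit. [cite: AroraBarak2009, §6.2, Remark 6.7] -/
theorem desc_codeFP_of_isUniform (hU : F.IsUniform) :
    CodeFP unE (pairE natE (pairE unE (fun w : List Bool => w))) (fun n => (n, F.ancillas n, (F.circ n).encode)) := by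
  refine ⟨F.descFn, descFn_mem_FP_of_isUniform hU, fun n => ?_⟩
  rw [descFn_unaryEncodeNat, QCircuit.sigmaEncode_eq]
  rfl

/-- **The ancilla count of a uniform family on codes** (unary in, unary out). [cite: AroraBarak2009, §6.2] -/
theorem ancillas_codeFP_of_isUniform (hU : F.IsUniform) : CodeFP unE unE F.ancillas :=
  ((desc_codeFP_of_isUniform F hU).snd'.fst').congr fun _ => rfl

/-- The gate-list code of a uniform family on codes. [cite: AroraBarak2009, §6.2] -/
theorem encode_codeFP_of_isUniform (hU : F.IsUniform) :
    CodeFP unE (fun w : List Bool => w) (fun n => (F.circ n).encode) :=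
  ((desc_codeFP_of_isUniform F hU).snd'.snd').congr fun _ => rfl

/-- **The abstract gate lists of an oracle-free uniform family are computed on codes.**
[cite: AroraBarak2009, §6.2, Remark 6.7] [cite: BennettBernsteinBrassardVazirani1997, Thm. 4.14] -/
theorem abstract_codeFP_of_isUniform (hU : F.IsUniform) (hfree : F.IsOracleFree) :
    CodeFP unE (rawE agE0) (fun n => (F.circ n).gates.map toAG) := by
  have h1 : CodeFP unE (rawE agE) (fun n => (F.circ n).gates.map toAG) :=
    (encode_codeFP_of_isUniform F hU).recodeOut fun n => encode_eq_rawE _ (hfree n)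
  exact ((map₀ agE0_of_agE).comp h1).congr fun _ => List.map_id _

end QCircuitFamily

end Literature.Computability.QuantumComplexity

end
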